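import Summits.Langlands.Langlands.Theorems.NonParallelVoidTwistedInductionParallelSymmetriseDefs
import HarnessLib

/-!
# Route `NonParallelVoid`, crux `TwistedInductionParallel` (stmt-Langlands-17000), line `symmetrise-pd-split`:
# vocabulary of skeleton v7 — waypoint 2' with `I|Γ_{K'}` irreducible

Lead prover `prover-line-stmt-Langlands-17000-0`, 2026-08-17 (the v4 Defs file
`NonParallelVoidTwistedInductionParallelSymmetriseDefs` is at the 400-line cap, so v7 vocabulary opens a
second Defs file).  The wave-2 stub-3' worker's verdict was `stub-misstated`: the Arthur–Clozel descent
needs the IRREDUCIBILITY of `I|Γ_{K'}` (`I = Ind_E^K(ρ|_E ⊗ χ)`; without it the two `GL₂`-constituents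
over `E K'` may cross-match when `W|_{E K'}` is reducible).  `InducedTwistAutomorphicIrr` is
`InducedTwistAutomorphic` with that one conjunct inserted; stub 3 (v7) supplies it from the avoid form of
BLGGT Thm. C (`BLGGT2014_thmC_potentialAutomorphy_avoid`), stub 3' (v7) consumes it.  The registered glue
stub `stub_inducedTwistAutomorphic_of_irr` (the projection onto the v4 waypoint) is proved here.
-/

noncomputable section

open scoped NumberField
open NumberField IsDedekindDomain Field Filter ValuativeRel
open Literature.NumberTheory.GaloisRepresentations Literature.NumberTheory.PAdicHodge
open Literature.NumberTheory.Automorphic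

-- `Summit.Langlands.Langlands.…` repeats a namespace component by design (D-0017 nested layout).
set_option linter.dupNamespace false

namespace Summit.Langlands.Langlands.Cruxes.TwistedInductionParallel.SymmetrisePdSplit

/-- **WAYPOINT 2' (v7) — the induced twist is automorphic over a totally real extension, WITH
`I|Γ_{K'}` IRREDUCIBLE**: `InducedTwistAutomorphic` (v4 Defs file) with one conjunct inserted after the
semisimplicity of `I|Γ_{K'}`.  [cite: BarnetlambEtAl2014, Thm. 4.5.1 and Cor. 4.5.2] -/
def InducedTwistAutomorphicIrr (F : Type) [Field F] [NumberField F] (p : ℕ) [Fact p.Prime]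
    (ρ : FramedGaloisRep F (PadicAlgCl p) 2) : Prop :=
  ∃ (K E : Type) (_ : Field K) (_ : NumberField K) (_ : Field E) (_ : NumberField E)
    (_ : Algebra F E) (_ : Algebra K E) (hd : Module.finrank K E = 2),
    NumberField.IsTotallyReal K ∧ NumberField.IsCMField E ∧
    ∃ (χ : absoluteGaloisGroup E →ₜ* (PadicAlgCl p)ˣ) (θ : absoluteGaloisGroup K →ₜ* (PadicAlgCl p)ˣ),
      IsLocallyAlgebraicAbove p E χ ∧
      (∃ (t : ℤ) (θ₀ : absoluteGaloisGroup K →ₜ* (PadicAlgCl p)ˣ), (Set.range θ₀).Finite ∧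
        ∀ σ : absoluteGaloisGroup K, ((θ σ : (PadicAlgCl p)ˣ) : PadicAlgCl p) =
          (θ₀ σ : PadicAlgCl p) *
            (algebraMap ℚ_[p] (PadicAlgCl p)
              ((GaloisRep.cyclotomicCharacter K p σ : ℤ_[p]ˣ) : ℤ_[p])) ^ t) ∧
      FramedRep.det (FramedRep.twist (ρ.restrictField E) χ) = θ.comp (absGaloisRestrict K E) ∧
      FramedGaloisRep.IsResiduallyAbsIrreducible
        ((FramedGaloisRep.induce K hd (FramedRep.twist (ρ.restrictField E) χ)).restrictField
          (CyclotomicField p K)) ∧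
      ∃ (K' : Type) (_ : Field K') (_ : NumberField K') (_ : Algebra K K'),
        IsGalois K K' ∧ NumberField.IsTotallyReal K' ∧
        ∃ ι : PadicAlgCl p ≃+* ℂ,
          (((FramedGaloisRep.induce K hd (FramedRep.twist (ρ.restrictField E) χ)).restrictField K')
              ).toGaloisRep.IsSemisimple ∧
          (((FramedGaloisRep.induce K hd (FramedRep.twist (ρ.restrictField E) χ)).restrictField K')
              ).toGaloisRep.IsIrreducible ∧
          ∃ (hcpt : isCompact_glFiniteIntegralLevel (2 * 2) K')
            (π₄ : CuspidalAutomorphicRepData (2 * 2) K' hcpt),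
            π₄.1.IsRegularAlgebraic ∧
            HarrisLanTaylorThorne2016.IsCompatible π₄.1 ι
              ((FramedGaloisRep.induce K hd (FramedRep.twist (ρ.restrictField E) χ)).restrictField K')

/-- **GLUE STUB (v7, registered; proved) — forgetting the irreducibility conjunct recovers waypoint 2'
of v4.** [folklore] -/
theorem stub_inducedTwistAutomorphic_of_irr :
    ∀ (F : Type) [Field F] [NumberField F] (p : ℕ) [Fact p.Prime] (ρ : FramedGaloisRep F (PadicAlgCl p) 2),
    InducedTwistAutomorphicIrr F p ρ → InducedTwistAutomorphic F p ρ := by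
  intro F _ _ p _ ρ h
  obtain ⟨K, E, _, _, _, _, _, _, hd, hK, hE, χ, θ, hχ, hθ, hdet, hirr, K', _, _, _, hGal, hK', ι, hss, -,
    hcpt, π₄, hRA, hC⟩ := h
  exact ⟨K, E, inferInstance, inferInstance, inferInstance, inferInstance, inferInstance, inferInstance,
    hd, hK, hE, χ, θ, hχ, hθ, hdet, hirr, K', inferInstance, inferInstance, inferInstance, hGal, hK', ι,
    hss, hcpt, π₄, hRA, hC⟩

end Summit.Langlands.Langlands.Cruxes.TwistedInductionParallel.SymmetrisePdSplit

end
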